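import Literature.Analysis.FluidPDE.NSRTimeGluing
import Literature.Analysis.FluidPDE.MollifiedStartTripleBounds
import Literature.Analysis.FluidPDE.EnergyPumpTools
import HarnessLib

/-!
# Tools for the energy stage of Buckmaster–Vicol (Ann. of Math. 189 (2019), §7), II: local
  agreement of one-sided time derivatives, time-rescaled tensor fields, and the cut-offs of an
  energy gap

Analysis/FluidPDE support file (everything proved; definitions are explicit constructions):

* **local agreement**: space–time fields that agree on a one-sided time neighbourhood within
  `S` have the same `Torus.timeDerivWithin S` there (and fields vanishing near `t` have vanishing
  time derivative); used to read off the derivatives of glued stresses zone by zone;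
* **time-rescaled tensor fields** `N(t) = g(t) • M(t)`: joint smoothness, the formulas for
  `∂ₗN`, `∂ₜN`, `∂ₜ∂ₗN`, `∂ₗ∂ₘN` and the resulting bounds;
* **cut-offs of a gap function** `θ = cut a h ∘ G` on `[0,T]`: smoothness, `0 ≤ θ ≤ 1`, the bounds
  `|θ'| ≤ (D₁/h)Λ₁`, `|θ''| ≤ (D₂/h²)Λ₁² + (D₁/h)Λ₂`, and the vanishing of `θ', θ''` wherever
  `θ ∈ {0, 1}` (i.e. `G ≤ a` or `G ≥ a + h`);
* the traceless part of a trace-free field is the field itself, and bounds for derivatives of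
  traceless parts.

## References

* T. Buckmaster, V. Vicol, Ann. of Math. 189 (2019) = arXiv:1709.10033, §7. [`BuckmasterVicol2019Annals`]
-/

noncomputable section

open MeasureTheory Set Filter Topology Function
open scoped InnerProductSpace ContDiff ENNReal NNReal

namespace Literature.Analysis.FluidPDE

namespace EnergyPump

open Literature.Analysis.FunctionSpaces FunctionSpaces.Torus Literature.Analysis.Calculus

variable {d : Type*} [Fintype d] [DecidableEq d]

/-! ## Local agreement of one-sided time derivatives -/

section Local

variable {F : Type*} [NormedAddCommGroup F] [NormedSpace ℝ F] {S : Set ℝ} {f g : ℝ → UnitAddTorus d → F} {t : ℝ}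

omit [Fintype d] [DecidableEq d] in
/-- Fields that agree near `t` within `S` (and at `t`) have the same one-sided time derivative at `t`. [folklore] -/
theorem timeDerivWithin_congr_of_eventuallyEq (h : ∀ᶠ s in 𝓝[S] t, f s = g s) (ht : f t = g t) (x : UnitAddTorus d) :
    Torus.timeDerivWithin S f t x = Torus.timeDerivWithin S g t x := by
  show derivWithin (fun s => f s x) S t = derivWithin (fun s => g s x) S t
  have h' : (fun s => f s x) =ᶠ[𝓝[S] t] fun s => g s x := h.mono fun s hs => by show f s x = g s x; rw [hs]
  exact h'.derivWithin_eq (by rw [ht])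

omit [Fintype d] [DecidableEq d] in
/-- Fields that agree on `{s ∈ S : |s - t| < r}` have the same one-sided time derivative at `t ∈ S`. [folklore] -/
theorem timeDerivWithin_congr_of_ball {r : ℝ} (hr : 0 < r) (ht : t ∈ S) (h : ∀ s ∈ S, |s - t| < r → f s = g s) (x : UnitAddTorus d) :
    Torus.timeDerivWithin S f t x = Torus.timeDerivWithin S g t x := by
  refine timeDerivWithin_congr_of_eventuallyEq ?_ (h t ht (by simpa using hr)) x
  have hmem : S ∩ Metric.ball t r ∈ 𝓝[S] t := inter_mem_nhdsWithin S (Metric.ball_mem_nhds t hr)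
  filter_upwards [hmem] with s hs
  exact h s hs.1 (by have := Metric.mem_ball.1 hs.2; rwa [Real.dist_eq] at this)

omit [Fintype d] [DecidableEq d] in
/-- A field vanishing on `{s ∈ S : |s - t| < r}` has vanishing one-sided time derivative at `t ∈ S`. [folklore] -/
theorem timeDerivWithin_eq_zero_of_ball {r : ℝ} (hr : 0 < r) (ht : t ∈ S) (h : ∀ s ∈ S, |s - t| < r → f s = 0) (x : UnitAddTorus d) :
    Torus.timeDerivWithin S f t x = 0 := by
  rw [timeDerivWithin_congr_of_ball (g := fun _ _ => 0) hr ht h x]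
  show derivWithin (fun _ : ℝ => (0 : F)) S t = 0
  simp

omit [Fintype d] in
/-- A field vanishing at time `t` has vanishing space derivatives at time `t`. [folklore] -/
theorem partialDeriv_eq_zero_of_eq_zero [Fintype d] (h : f t = 0) (i : d) (x : UnitAddTorus d) : Torus.partialDeriv i (f t) x = 0 := by
  rw [h]; exact Torus.partialDeriv_const_apply (0 : F) i x

end Local

/-! ## Time-rescaled tensor fields `N = g • M` -/

section Rescale

variable {T : ℝ} {g : ℝ → ℝ} {M : ℝ → UnitAddTorus d → d → EuclideanSpace ℝ d}

/-- **The time-rescaled field** `N(t) = g(t) • M(t)`. [folklore] -/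
def tscale (g : ℝ → ℝ) (M : ℝ → UnitAddTorus d → d → EuclideanSpace ℝ d) (t : ℝ) : UnitAddTorus d → d → EuclideanSpace ℝ d :=
  g t • M t

omit [Fintype d] [DecidableEq d] in
/-- Unfolding. [folklore] -/
@[simp] theorem tscale_apply (g : ℝ → ℝ) (M : ℝ → UnitAddTorus d → d → EuclideanSpace ℝ d) (t : ℝ) (x : UnitAddTorus d) (j : d) :
    tscale g M t x j = g t • M t x j := rfl

omit [DecidableEq d] in
/-- `N` is jointly smooth. [folklore] -/
theorem isSmoothSpaceTimeOn_tscale {S : Set ℝ} (hg : ContDiffOn ℝ ∞ g S) (hM : FunctionSpaces.Torus.IsSmoothSpaceTimeOn S M) :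
    FunctionSpaces.Torus.IsSmoothSpaceTimeOn S (tscale g M) :=
  (Torus.isSmoothSpaceTimeOn_time hg).smul hM

omit [Fintype d] [DecidableEq d] in
/-- `N` is symmetric when `M` is. [folklore] -/
theorem tscale_symm {t : ℝ} {x : UnitAddTorus d} (h : ∀ i j, M t x i j = M t x j i) (i j : d) : tscale g M t x i j = tscale g M t x j i := by
  simp [tscale, h i j]

/-- `∂ₗN = g ∂ₗM`. [folklore] -/
theorem partialDeriv_tscale {t : ℝ} (hM : IsSmooth (M t)) (l : d) :
    Torus.partialDeriv l (tscale g M t) = g t • Torus.partialDeriv l (M t) := by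
  show Torus.partialDeriv l (g t • M t) = _
  exact Torus.partialDeriv_const_smul (hM.isContDiff (by simp)) (g t) l

/-- `∂ₗ∂ₘN = g ∂ₗ∂ₘM`. [folklore] -/
theorem partialDeriv_partialDeriv_tscale {t : ℝ} (hM : IsSmooth (M t)) (l m : d) :
    Torus.partialDeriv l (Torus.partialDeriv m (tscale g M t)) = g t • Torus.partialDeriv l (Torus.partialDeriv m (M t)) := by
  rw [partialDeriv_tscale hM m]
  exact Torus.partialDeriv_const_smul ((hM.partialDeriv m).isContDiff (by simp)) (g t) l

omit [DecidableEq d] in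
/-- **`∂ₜN = g' M + g ∂ₜM`** within `[0,T]`. [folklore] -/
theorem timeDerivWithin_tscale (hT : 0 < T) (hg : ContDiffOn ℝ ∞ g (Icc 0 T)) (hM : FunctionSpaces.Torus.IsSmoothSpaceTimeOn (Icc 0 T) M)
    {t : ℝ} (ht : t ∈ Icc 0 T) (x : UnitAddTorus d) :
    Torus.timeDerivWithin (Icc 0 T) (tscale g M) t x =
      derivWithin g (Icc 0 T) t • M t x + g t • Torus.timeDerivWithin (Icc 0 T) M t x := by
  have hgd : HasDerivWithinAt g (derivWithin g (Icc 0 T) t) (Icc 0 T) t := ((hg.differentiableOn (by simp)) t ht).hasDerivWithinAt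
  have hMd := hM.hasDerivWithinAt_slice ht x
  have key : HasDerivWithinAt (fun s => tscale g M s x) (g t • Torus.timeDerivWithin (Icc 0 T) M t x + derivWithin g (Icc 0 T) t • M t x) (Icc 0 T) t :=
    hgd.smul hMd
  show derivWithin (fun s => tscale g M s x) (Icc 0 T) t = _
  rw [key.derivWithin (uniqueDiffOn_Icc hT t ht), add_comm]

/-- **`∂ₜ∂ₗN = g' ∂ₗM + g ∂ₜ∂ₗM`** within `[0,T]`. [folklore] -/
theorem timeDerivWithin_partialDeriv_tscale (hT : 0 < T) (hg : ContDiffOn ℝ ∞ g (Icc 0 T)) (hM : FunctionSpaces.Torus.IsSmoothSpaceTimeOn (Icc 0 T) M)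
    {t : ℝ} (ht : t ∈ Icc 0 T) (x : UnitAddTorus d) (l : d) :
    Torus.timeDerivWithin (Icc 0 T) (fun s y => Torus.partialDeriv l (tscale g M s) y) t x =
      derivWithin g (Icc 0 T) t • Torus.partialDeriv l (M t) x + g t • Torus.timeDerivWithin (Icc 0 T) (fun s y => Torus.partialDeriv l (M s) y) t x := by
  have hMl : FunctionSpaces.Torus.IsSmoothSpaceTimeOn (Icc 0 T) (fun s => Torus.partialDeriv l (M s)) := hM.partialDeriv (uniqueDiffOn_Icc hT) l
  have heq : EqOn (fun s => Torus.partialDeriv l (tscale g M s) x) (fun s => tscale g (fun s => Torus.partialDeriv l (M s)) s x) (Icc 0 T) := by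
    intro s hs
    show Torus.partialDeriv l (tscale g M s) x = tscale g (fun s => Torus.partialDeriv l (M s)) s x
    rw [partialDeriv_tscale (hM.isSmooth_slice hs) l]; rfl
  have e1 : Torus.timeDerivWithin (Icc 0 T) (fun s y => Torus.partialDeriv l (tscale g M s) y) t x =
      Torus.timeDerivWithin (Icc 0 T) (tscale g (fun s => Torus.partialDeriv l (M s))) t x := by
    show derivWithin (fun s => Torus.partialDeriv l (tscale g M s) x) (Icc 0 T) t = derivWithin (fun s => tscale g (fun s => Torus.partialDeriv l (M s)) s x) (Icc 0 T) t
    exact derivWithin_congr heq (heq ht)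
  rw [e1, timeDerivWithin_tscale hT hg hMl ht x]

/-- **Bounds of the rescaled field.** If `|g| ≤ γ` and `|g'| ≤ γ'` on `[0,T]`, then
`‖N‖ ≤ γ‖M‖`, `‖∂ₗN‖ ≤ γ‖∂ₗM‖`, `‖∂ₗ∂ₘN‖ ≤ γ‖∂ₗ∂ₘM‖`, `‖∂ₜN‖ ≤ γ'‖M‖ + γ‖∂ₜM‖`,
`‖∂ₜ∂ₗN‖ ≤ γ'‖∂ₗM‖ + γ‖∂ₜ∂ₗM‖`. [folklore] -/
theorem tscale_bounds (hT : 0 < T) (hg : ContDiffOn ℝ ∞ g (Icc 0 T)) (hM : FunctionSpaces.Torus.IsSmoothSpaceTimeOn (Icc 0 T) M)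
    {γ γ' : ℝ} (hγ : ∀ t ∈ Icc 0 T, |g t| ≤ γ) (hγ' : ∀ t ∈ Icc 0 T, |derivWithin g (Icc 0 T) t| ≤ γ')
    {t : ℝ} (ht : t ∈ Icc 0 T) (x : UnitAddTorus d) (l m : d) :
    ‖tscale g M t x‖ ≤ γ * ‖M t x‖ ∧
    ‖Torus.partialDeriv l (tscale g M t) x‖ ≤ γ * ‖Torus.partialDeriv l (M t) x‖ ∧
    ‖Torus.partialDeriv l (Torus.partialDeriv m (tscale g M t)) x‖ ≤ γ * ‖Torus.partialDeriv l (Torus.partialDeriv m (M t)) x‖ ∧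
    ‖Torus.timeDerivWithin (Icc 0 T) (tscale g M) t x‖ ≤ γ' * ‖M t x‖ + γ * ‖Torus.timeDerivWithin (Icc 0 T) M t x‖ ∧
    ‖Torus.timeDerivWithin (Icc 0 T) (fun s y => Torus.partialDeriv l (tscale g M s) y) t x‖ ≤
      γ' * ‖Torus.partialDeriv l (M t) x‖ + γ * ‖Torus.timeDerivWithin (Icc 0 T) (fun s y => Torus.partialDeriv l (M s) y) t x‖ := by
  have hMt : IsSmooth (M t) := hM.isSmooth_slice ht
  have n1 : ∀ (c : ℝ) (w : d → EuclideanSpace ℝ d) (B : ℝ), |c| ≤ B → ‖c • w‖ ≤ B * ‖w‖ := fun c w B hc => by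
    rw [norm_smul, Real.norm_eq_abs]; exact mul_le_mul_of_nonneg_right hc (norm_nonneg _)
  refine ⟨?_, ?_, ?_, ?_, ?_⟩
  · exact n1 _ _ _ (hγ t ht)
  · rw [partialDeriv_tscale hMt l, Pi.smul_apply]; exact n1 _ _ _ (hγ t ht)
  · rw [partialDeriv_partialDeriv_tscale hMt l m, Pi.smul_apply]; exact n1 _ _ _ (hγ t ht)
  · rw [timeDerivWithin_tscale hT hg hM ht x]
    exact (norm_add_le _ _).trans (add_le_add (n1 _ _ _ (hγ' t ht)) (n1 _ _ _ (hγ t ht)))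
  · rw [timeDerivWithin_partialDeriv_tscale hT hg hM ht x l]
    exact (norm_add_le _ _).trans (add_le_add (n1 _ _ _ (hγ' t ht)) (n1 _ _ _ (hγ t ht)))

end Rescale

/-! ## Cut-offs of a gap function on `[0,T]` -/

section GapCut

variable {T a h : ℝ} {G : ℝ → ℝ}

/-- **The cut-off of a gap function**: `θ(t) = cut a h (G t)`. [cite: BuckmasterVicol2019Annals, §7] -/
def gapCut (a h : ℝ) (G : ℝ → ℝ) (t : ℝ) : ℝ := cut a h (G t)

/-- `0 ≤ θ ≤ 1`. [folklore] -/
theorem gapCut_mem (a h : ℝ) (G : ℝ → ℝ) (t : ℝ) : 0 ≤ gapCut a h G t ∧ gapCut a h G t ≤ 1 := cut_mem a h (G t)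

/-- `θ = 0` where `G ≤ a`. [folklore] -/
theorem gapCut_of_le (hh : 0 < h) {t : ℝ} (hG : G t ≤ a) : gapCut a h G t = 0 := cut_of_le hh hG

/-- `θ = 1` where `G ≥ a + h`. [folklore] -/
theorem gapCut_of_ge (hh : 0 < h) {t : ℝ} (hG : a + h ≤ G t) : gapCut a h G t = 1 := cut_of_ge hh hG

/-- `θ < 1 ⇒ G < a + h`. [folklore] -/
theorem lt_of_gapCut_lt_one (hh : 0 < h) {t : ℝ} (hθ : gapCut a h G t < 1) : G t < a + h := by
  by_contra hc; exact hθ.ne (gapCut_of_ge hh (le_of_not_gt hc))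

/-- `0 < θ ⇒ a < G`. [folklore] -/
theorem lt_of_gapCut_pos (hh : 0 < h) {t : ℝ} (hθ : 0 < gapCut a h G t) : a < G t := by
  by_contra hc; exact hθ.ne' (gapCut_of_le hh (le_of_not_gt hc))

/-- `θ ≠ 0 ⇒ a < G`. [folklore] -/
theorem lt_of_gapCut_ne_zero (hh : 0 < h) {t : ℝ} (hθ : gapCut a h G t ≠ 0) : a < G t :=
  lt_of_gapCut_pos hh (lt_of_le_of_ne (gapCut_mem a h G t).1 hθ.symm)

/-- `θ ≠ 1 ⇒ G < a + h`. [folklore] -/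
theorem lt_of_gapCut_ne_one (hh : 0 < h) {t : ℝ} (hθ : gapCut a h G t ≠ 1) : G t < a + h :=
  lt_of_gapCut_lt_one hh (lt_of_le_of_ne (gapCut_mem a h G t).2 hθ)

/-- `θ` is `C^∞` on `[0,T]`. [folklore] -/
theorem contDiffOn_gapCut (hG : ContDiffOn ℝ ∞ G (Icc 0 T)) : ContDiffOn ℝ ∞ (gapCut a h G) (Icc 0 T) :=
  contDiffOn_comp (g := cut a h) (G := G) (contDiff_cut a h) hG

/-- `θ' = cut'(G) G'` within `[0,T]`. [folklore] -/
theorem derivWithin_gapCut (hT : 0 < T) (hG : ContDiffOn ℝ ∞ G (Icc 0 T)) {t : ℝ} (ht : t ∈ Icc 0 T) :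
    derivWithin (gapCut a h G) (Icc 0 T) t = deriv (cut a h) (G t) * derivWithin G (Icc 0 T) t :=
  derivWithin_comp hT (contDiff_cut a h) hG ht

/-- **`|θ'| ≤ (D₁/h) Λ₁`**. [folklore] -/
theorem abs_derivWithin_gapCut_le (hT : 0 < T) (hh : 0 < h) (hG : ContDiffOn ℝ ∞ G (Icc 0 T)) {Λ₁ : ℝ}
    (hΛ : ∀ t ∈ Icc 0 T, |derivWithin G (Icc 0 T) t| ≤ Λ₁) {t : ℝ} (ht : t ∈ Icc 0 T) :
    |derivWithin (gapCut a h G) (Icc 0 T) t| ≤ D₁ / h * Λ₁ :=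
  abs_derivWithin_comp_le hT (contDiff_cut a h) hG (fun y => abs_deriv_cut_le hh y) hΛ ht

/-- **`|θ''| ≤ (D₂/h²) Λ₁² + (D₁/h) Λ₂`**. [folklore] -/
theorem abs_derivWithin_derivWithin_gapCut_le (hT : 0 < T) (hh : 0 < h) (hG : ContDiffOn ℝ ∞ G (Icc 0 T)) {Λ₁ Λ₂ : ℝ}
    (hΛ : ∀ t ∈ Icc 0 T, |derivWithin G (Icc 0 T) t| ≤ Λ₁) (hΛ₂ : ∀ t ∈ Icc 0 T, |derivWithin (derivWithin G (Icc 0 T)) (Icc 0 T) t| ≤ Λ₂)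
    {t : ℝ} (ht : t ∈ Icc 0 T) :
    |derivWithin (derivWithin (gapCut a h G) (Icc 0 T)) (Icc 0 T) t| ≤ D₂ / h ^ 2 * Λ₁ ^ 2 + D₁ / h * Λ₂ :=
  abs_derivWithin_derivWithin_comp_le hT (contDiff_cut a h) hG (fun y => abs_deriv_cut_le hh y) (fun y => abs_deriv_deriv_cut_le hh y) hΛ hΛ₂ ht

/-- **Where `θ ∈ {0,1}` the cut-off is flat**: `G ≤ a` or `G ≥ a + h` forces `θ' = 0`. [folklore] -/
theorem derivWithin_gapCut_eq_zero (hT : 0 < T) (hh : 0 < h) (hG : ContDiffOn ℝ ∞ G (Icc 0 T)) {t : ℝ} (ht : t ∈ Icc 0 T)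
    (hGt : G t ≤ a ∨ a + h ≤ G t) : derivWithin (gapCut a h G) (Icc 0 T) t = 0 := by
  rw [derivWithin_gapCut hT hG ht]
  rcases hGt with h1 | h1
  · rw [deriv_cut_of_le hh h1, zero_mul]
  · rw [deriv_cut_of_ge hh h1, zero_mul]

/-- … and `θ'' = 0`. [folklore] -/
theorem derivWithin_derivWithin_gapCut_eq_zero (hT : 0 < T) (hh : 0 < h) (hG : ContDiffOn ℝ ∞ G (Icc 0 T)) {t : ℝ} (ht : t ∈ Icc 0 T)
    (hGt : G t ≤ a ∨ a + h ≤ G t) : derivWithin (derivWithin (gapCut a h G) (Icc 0 T)) (Icc 0 T) t = 0 := by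
  rw [show gapCut a h G = fun s => cut a h (G s) from rfl, derivWithin_derivWithin_comp hT (contDiff_cut a h) hG ht]
  rcases hGt with h1 | h1
  · rw [deriv_cut_of_le hh h1, deriv_deriv_cut_of_le hh h1]; ring
  · rw [deriv_cut_of_ge hh h1, deriv_deriv_cut_of_ge hh h1]; ring

/-- `θ = 1 ⇒ θ' = θ'' = 0`; `θ = 0 ⇒ θ' = θ'' = 0`. [folklore] -/
theorem gapCut_flat (hT : 0 < T) (hh : 0 < h) (hG : ContDiffOn ℝ ∞ G (Icc 0 T)) {t : ℝ} (ht : t ∈ Icc 0 T)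
    (hθ : gapCut a h G t = 0 ∨ gapCut a h G t = 1) :
    derivWithin (gapCut a h G) (Icc 0 T) t = 0 ∧ derivWithin (derivWithin (gapCut a h G) (Icc 0 T)) (Icc 0 T) t = 0 := by
  have hGt : G t ≤ a ∨ a + h ≤ G t := by
    rcases hθ with h0 | h1
    · left; by_contra hc
      exact (cut_pos hh (lt_of_not_ge hc)).ne' h0
    · right; by_contra hc
      have hlt : G t < a + h := lt_of_not_ge hc
      -- `cut < 1` strictly below `a + h`: `S(x) < 1` for `x < 1`
      have : cut a h (G t) < 1 := by
        unfold cut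
        have hx : (G t - a) / h < 1 := (div_lt_one hh).2 (by linarith)
        exact Real.smoothTransition.lt_one_of_lt_one hx
      exact this.ne h1
  exact ⟨derivWithin_gapCut_eq_zero hT hh hG ht hGt, derivWithin_derivWithin_gapCut_eq_zero hT hh hG ht hGt⟩

end GapCut

/-! ## Traceless parts -/

section Traceless

variable {T : ℝ}

/-- The traceless part of a trace-free field is the field. [folklore] -/
theorem traceless_eq_self_of_traceFree {S : UnitAddTorus d → d → EuclideanSpace ℝ d} (h : ∀ x, ∑ i, S x i i = 0) :
    Torus.traceless S = S := by
  funext x j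
  rw [Torus.traceless_apply, show Torus.tensorTrace S x = 0 from h x, zero_div, zero_smul, sub_zero]

/-- `‖∂ₗS̊‖ ≤ (d+1)‖∂ₗS‖`. [folklore] -/
theorem norm_partialDeriv_traceless_le {S : UnitAddTorus d → d → EuclideanSpace ℝ d} (hS : IsSmooth S) (l : d) (x : UnitAddTorus d) :
    ‖Torus.partialDeriv l (Torus.traceless S) x‖ ≤ (Fintype.card d + 1) * ‖Torus.partialDeriv l S x‖ := by
  rw [Torus.traceless_eq_comp, Torus.partialDeriv_clm_comp hS]
  exact Torus.norm_tracelessCLM_le _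

/-- `‖∂ₜS̊‖ ≤ (d+1)‖∂ₜS‖` within `[0,T]`. [folklore] -/
theorem norm_timeDerivWithin_traceless_le (hT : 0 < T) {S : ℝ → UnitAddTorus d → d → EuclideanSpace ℝ d}
    (hS : FunctionSpaces.Torus.IsSmoothSpaceTimeOn (Icc 0 T) S) {t : ℝ} (ht : t ∈ Icc 0 T) (x : UnitAddTorus d) :
    ‖Torus.timeDerivWithin (Icc 0 T) (fun s => Torus.traceless (S s)) t x‖ ≤ (Fintype.card d + 1) * ‖Torus.timeDerivWithin (Icc 0 T) S t x‖ := by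
  have hd := hS.hasDerivWithinAt_slice ht x
  have key : HasDerivWithinAt (fun s => Torus.traceless (S s) x) (Torus.tracelessCLM (Torus.timeDerivWithin (Icc 0 T) S t x)) (Icc 0 T) t := by
    have e : (fun s => Torus.traceless (S s) x) = fun s => Torus.tracelessCLM (S s x) := by
      funext s; rw [Torus.traceless_eq_comp]; rfl
    rw [e]
    exact Torus.tracelessCLM.hasFDerivAt.comp_hasDerivWithinAt t hd
  have e1 : Torus.timeDerivWithin (Icc 0 T) (fun s => Torus.traceless (S s)) t x = Torus.tracelessCLM (Torus.timeDerivWithin (Icc 0 T) S t x) :=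
    key.derivWithin (uniqueDiffOn_Icc hT t ht)
  rw [e1]
  exact Torus.norm_tracelessCLM_le _

/-- `‖S̊‖ ≤ (d+1)‖S‖`. [folklore] -/
theorem norm_traceless_le' (S : UnitAddTorus d → d → EuclideanSpace ℝ d) (x : UnitAddTorus d) :
    ‖Torus.traceless S x‖ ≤ (Fintype.card d + 1) * ‖S x‖ := by
  rw [Torus.traceless_eq_comp]; exact Torus.norm_tracelessCLM_le _

/-- `S̊` is jointly smooth. [folklore] -/
theorem isSmoothSpaceTimeOn_traceless {S' : Set ℝ} {S : ℝ → UnitAddTorus d → d → EuclideanSpace ℝ d}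
    (hS : FunctionSpaces.Torus.IsSmoothSpaceTimeOn S' S) : FunctionSpaces.Torus.IsSmoothSpaceTimeOn S' (fun s => Torus.traceless (S s)) :=
  hS.traceless

end Traceless

end EnergyPump

/-! ## Weighted `C¹` bounds for the glued stress of `NSRTimeGluing`

The bounds `Torus.norm_partialDeriv_glueStress_le` / `norm_timeDerivWithin_glueStress_le` with the
weights `(1-θ)`, `θ` kept in front of the derivatives of `R₀`, `R₁` (needed where one of the two
stresses is not controlled in `C¹` but its weight vanishes), and the `L¹` size of the glued stress. -/

namespace Torus

open FunctionSpaces FunctionSpaces.Torus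

variable {d : Type*} [Fintype d] [DecidableEq d]
variable {T : ℝ} {θ : ℝ → ℝ} {v₀ v₁ : ℝ → UnitAddTorus d → EuclideanSpace ℝ d} {p₀ p₁ : ℝ → UnitAddTorus d → ℝ}
  {R₀ R₁ : ℝ → UnitAddTorus d → d → EuclideanSpace ℝ d} {ν : ℝ}

variable (h₀ : IsNSReynoldsOn (Icc 0 T) ν v₀ p₀ R₀) (h₁ : IsNSReynoldsOn (Icc 0 T) ν v₁ p₁ R₁) (hT : 0 < T)
  (hθ : ContDiffOn ℝ ∞ θ (Icc 0 T))
include h₀ h₁ hT hθ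

omit hT hθ in
/-- **Space derivatives of the glued stress, weighted form**:
`‖∂ₗR_θ‖ ≤ (1-θ)‖∂ₗR₀‖ + θ‖∂ₗR₁‖ + D₀D₁ + K|θ'|D₁`. [folklore] -/
theorem norm_partialDeriv_glueStress_le_weighted {K : ℝ}
    (hK : ∀ (w : UnitAddTorus d → EuclideanSpace ℝ d), IsSmooth w → ∀ C : ℝ, 0 ≤ C → (∀ x, ‖w x‖ ≤ C) → ∀ x, ‖antidivergence w x‖ ≤ K * C)
    {t : ℝ} (ht : t ∈ Icc 0 T) (hθ0 : 0 ≤ θ t) (hθ1 : θ t ≤ 1) (l : d) {D₀ D₁ : ℝ} (hD0 : 0 ≤ D₀) (hD1 : 0 ≤ D₁)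
    (hD : ∀ z, ‖glueDiff v₀ v₁ t z‖ ≤ D₀) (hDl : ∀ z, ‖FunctionSpaces.Torus.partialDeriv l (glueDiff v₀ v₁ t) z‖ ≤ D₁) (y : UnitAddTorus d) :
    ‖FunctionSpaces.Torus.partialDeriv l (glueStress T θ v₀ v₁ R₀ R₁ t) y‖ ≤
      (1 - θ t) * ‖FunctionSpaces.Torus.partialDeriv l (R₀ t) y‖ + θ t * ‖FunctionSpaces.Torus.partialDeriv l (R₁ t) y‖ + D₀ * D₁ +
        K * (|glueRate T θ t| * D₁) := by
  have hdt : IsSmooth (glueDiff v₀ v₁ t) := (smooth_glueDiff h₀ h₁).isSmooth_slice ht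
  have hR₀ : IsSmooth (R₀ t) := h₀.smooth_stress.isSmooth_slice ht
  have hR₁ : IsSmooth (R₁ t) := h₁.smooth_stress.isSmooth_slice ht
  have hTsq : IsSmooth (tracelessSq (glueDiff v₀ v₁ t)) := hdt.tracelessSq
  set a := θ t with ha
  set a' := glueRate T θ t with ha'
  have hrt : IsSmooth (fun z => a' • glueDiff v₀ v₁ t z) := (isSmooth_const _).smul' hdt
  have hAn : IsSmooth (antidivergence (fun z => a' • glueDiff v₀ v₁ t z)) := isSmooth_antidivergence hrt
  have sA : IsSmooth (fun z => (1 - a) • R₀ t z) := hR₀.smul (1 - a)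
  have sB : IsSmooth (fun z => a • R₁ t z) := hR₁.smul a
  have sC : IsSmooth (fun z => (a * (1 - a)) • tracelessSq (glueDiff v₀ v₁ t) z) := hTsq.smul _
  have sAB : IsSmooth (fun z => (1 - a) • R₀ t z + a • R₁ t z) := sA.add sB
  have sABC : IsSmooth (fun z => ((1 - a) • R₀ t z + a • R₁ t z) - (a * (1 - a)) • tracelessSq (glueDiff v₀ v₁ t) z) := sAB.sub sC
  have c1 : ∀ {f : UnitAddTorus d → d → EuclideanSpace ℝ d}, IsSmooth f → IsContDiff 1 f := fun hf => hf.isContDiff (by simp)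
  have e : glueStress T θ v₀ v₁ R₀ R₁ t = fun z => (((1 - a) • R₀ t z + a • R₁ t z) - (a * (1 - a)) • tracelessSq (glueDiff v₀ v₁ t) z) +
      antidivergence (fun z => a' • glueDiff v₀ v₁ t z) z := by
    funext z j; simp [glueStress, ha, ha']
  rw [e, partialDeriv_add_apply (c1 sABC) (c1 hAn), partialDeriv_sub_at (c1 sAB) (c1 sC), partialDeriv_add_apply (c1 sA) (c1 sB),
    partialDeriv_const_smul_at (c1 hR₀), partialDeriv_const_smul_at (c1 hR₁), partialDeriv_const_smul_at (c1 hTsq),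
    partialDeriv_antidivergence_tensor hrt l y]
  have hprod : a * (1 - a) ≤ 1 / 4 := by nlinarith [sq_nonneg (a - 1 / 2)]
  have hprod0 : 0 ≤ a * (1 - a) := mul_nonneg hθ0 (by linarith)
  have p3 : ‖(a * (1 - a)) • FunctionSpaces.Torus.partialDeriv l (tracelessSq (glueDiff v₀ v₁ t)) y‖ ≤ D₀ * D₁ := by
    rw [norm_smul, Real.norm_eq_abs, abs_of_nonneg hprod0]
    have h4 := norm_partialDeriv_tracelessSq_le hdt l y
    have h5 : 4 * ‖glueDiff v₀ v₁ t y‖ * ‖FunctionSpaces.Torus.partialDeriv l (glueDiff v₀ v₁ t) y‖ ≤ 4 * D₀ * D₁ := by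
      have := hD y; have := hDl y
      gcongr
    calc a * (1 - a) * ‖FunctionSpaces.Torus.partialDeriv l (tracelessSq (glueDiff v₀ v₁ t)) y‖ ≤ (1 / 4) * (4 * D₀ * D₁) :=
          mul_le_mul hprod (h4.trans h5) (norm_nonneg _) (by norm_num)
      _ = D₀ * D₁ := by ring
  have p4 : ‖antidivergence (FunctionSpaces.Torus.partialDeriv l fun z => a' • glueDiff v₀ v₁ t z) y‖ ≤ K * (|a'| * D₁) := by
    have ed : FunctionSpaces.Torus.partialDeriv l (fun z => a' • glueDiff v₀ v₁ t z) = fun z => a' • FunctionSpaces.Torus.partialDeriv l (glueDiff v₀ v₁ t) z := by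
      funext z; exact partialDeriv_const_smul_at (hdt.isContDiff (by simp)) a' l z
    rw [ed]
    exact hK _ ((isSmooth_const _).smul' (hdt.partialDeriv l)) _ (by positivity)
      (fun z => by rw [norm_smul, Real.norm_eq_abs]; exact mul_le_mul_of_nonneg_left (hDl z) (abs_nonneg _)) y
  have p1 : ‖(1 - a) • FunctionSpaces.Torus.partialDeriv l (R₀ t) y‖ = (1 - a) * ‖FunctionSpaces.Torus.partialDeriv l (R₀ t) y‖ := by
    rw [norm_smul, Real.norm_eq_abs, abs_of_nonneg (by linarith)]
  have p2 : ‖a • FunctionSpaces.Torus.partialDeriv l (R₁ t) y‖ = a * ‖FunctionSpaces.Torus.partialDeriv l (R₁ t) y‖ := by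
    rw [norm_smul, Real.norm_eq_abs, abs_of_nonneg hθ0]
  calc ‖(1 - a) • FunctionSpaces.Torus.partialDeriv l (R₀ t) y + a • FunctionSpaces.Torus.partialDeriv l (R₁ t) y -
        (a * (1 - a)) • FunctionSpaces.Torus.partialDeriv l (tracelessSq (glueDiff v₀ v₁ t)) y +
        antidivergence (FunctionSpaces.Torus.partialDeriv l fun z => a' • glueDiff v₀ v₁ t z) y‖
      ≤ (‖(1 - a) • FunctionSpaces.Torus.partialDeriv l (R₀ t) y‖ + ‖a • FunctionSpaces.Torus.partialDeriv l (R₁ t) y‖ +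
          ‖(a * (1 - a)) • FunctionSpaces.Torus.partialDeriv l (tracelessSq (glueDiff v₀ v₁ t)) y‖) +
          ‖antidivergence (FunctionSpaces.Torus.partialDeriv l fun z => a' • glueDiff v₀ v₁ t z) y‖ :=
        (norm_add_le _ _).trans (add_le_add ((norm_sub_le _ _).trans (add_le_add (norm_add_le _ _) le_rfl)) le_rfl)
    _ ≤ ((1 - a) * ‖FunctionSpaces.Torus.partialDeriv l (R₀ t) y‖ + a * ‖FunctionSpaces.Torus.partialDeriv l (R₁ t) y‖ + D₀ * D₁) + K * (|a'| * D₁) := by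
        rw [p1, p2]; gcongr

/-- **Time derivative of the glued stress, weighted form**:
`‖∂ₜR_θ‖ ≤ |θ'|(‖R₀‖ + ‖R₁‖) + (1-θ)‖∂ₜR₀‖ + θ‖∂ₜR₁‖ + 2|θ'|D₀² + D₀Dₜ + K(|θ''|D₀ + |θ'|Dₜ)`. [folklore] -/
theorem norm_timeDerivWithin_glueStress_le_weighted {K : ℝ}
    (hK : ∀ (w : UnitAddTorus d → EuclideanSpace ℝ d), IsSmooth w → ∀ C : ℝ, 0 ≤ C → (∀ x, ‖w x‖ ≤ C) → ∀ x, ‖antidivergence w x‖ ≤ K * C)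
    {t : ℝ} (ht : t ∈ Icc 0 T) (hθ0 : 0 ≤ θ t) (hθ1 : θ t ≤ 1) {D₀ Dt : ℝ} (hD0 : 0 ≤ D₀) (hDt0 : 0 ≤ Dt)
    (hD : ∀ z, ‖glueDiff v₀ v₁ t z‖ ≤ D₀) (hDt : ∀ z, ‖FunctionSpaces.Torus.timeDerivWithin (Icc 0 T) (glueDiff v₀ v₁) t z‖ ≤ Dt)
    (y : UnitAddTorus d) :
    ‖FunctionSpaces.Torus.timeDerivWithin (Icc 0 T) (glueStress T θ v₀ v₁ R₀ R₁) t y‖ ≤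
      |glueRate T θ t| * (‖R₀ t y‖ + ‖R₁ t y‖) + (1 - θ t) * ‖FunctionSpaces.Torus.timeDerivWithin (Icc 0 T) R₀ t y‖ +
        θ t * ‖FunctionSpaces.Torus.timeDerivWithin (Icc 0 T) R₁ t y‖ + 2 * |glueRate T θ t| * D₀ ^ 2 + D₀ * Dt +
        K * (|derivWithin (glueRate T θ) (Icc 0 T) t| * D₀ + |glueRate T θ t| * Dt) := by
  have hU : UniqueDiffOn ℝ (Icc (0 : ℝ) T) := uniqueDiffOn_Icc hT
  have hdst := smooth_glueDiff h₀ h₁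
  have hrd := smooth_rate_smul_glueDiff h₀ h₁ hT hθ
  have hdt : IsSmooth (glueDiff v₀ v₁ t) := hdst.isSmooth_slice ht
  set a := θ t with ha
  set a' := glueRate T θ t with ha'
  set a'' := derivWithin (glueRate T θ) (Icc 0 T) t with ha''
  have hθd : HasDerivWithinAt θ a' (Icc 0 T) t := (hθ.differentiableOn (by simp) t ht).hasDerivWithinAt
  have hθ'd : HasDerivWithinAt (glueRate T θ) a'' (Icc 0 T) t :=
    ((contDiffOn_derivWithin_Icc hT hθ).differentiableOn (by simp) t ht).hasDerivWithinAt
  have k1θ : HasDerivWithinAt (fun s => 1 - θ s) (0 - a') (Icc 0 T) t := (hasDerivWithinAt_const t (Icc 0 T) (1 : ℝ)).sub hθd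
  have kprod : HasDerivWithinAt (fun s => θ s * (1 - θ s)) (a' * (1 - a) + a * (0 - a')) (Icc 0 T) t := hθd.mul k1θ
  have kR₀ := h₀.smooth_stress.hasDerivWithinAt_slice ht y
  have kR₁ := h₁.smooth_stress.hasDerivWithinAt_slice ht y
  have kT := (isSmoothSpaceTimeOn_tracelessSq' hdst).hasDerivWithinAt_slice ht y
  have kA := (hrd.antidivergence (convex_Icc 0 T) (by rw [interior_Icc]; exact nonempty_Ioo.2 hT)).hasDerivWithinAt_slice ht y
  set DR₀ := FunctionSpaces.Torus.timeDerivWithin (Icc 0 T) R₀ t y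
  set DR₁ := FunctionSpaces.Torus.timeDerivWithin (Icc 0 T) R₁ t y
  set DT := FunctionSpaces.Torus.timeDerivWithin (Icc 0 T) (fun s => tracelessSq (glueDiff v₀ v₁ s)) t y
  set DA := FunctionSpaces.Torus.timeDerivWithin (Icc 0 T) (fun s => antidivergence (fun z => glueRate T θ s • glueDiff v₀ v₁ s z)) t y
  have key : HasDerivWithinAt (fun s => glueStress T θ v₀ v₁ R₀ R₁ s y)
      (((1 - θ t) • DR₀ + (0 - a') • R₀ t y) + (θ t • DR₁ + a' • R₁ t y) -
        ((θ t * (1 - θ t)) • DT + (a' * (1 - a) + a * (0 - a')) • tracelessSq (glueDiff v₀ v₁ t) y) + DA) (Icc 0 T) t := by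
    have h := (((k1θ.smul kR₀).add (hθd.smul kR₁)).sub (kprod.smul kT)).add kA
    exact h
  have e := key.derivWithin (hU t ht)
  unfold FunctionSpaces.Torus.timeDerivWithin at e ⊢
  rw [show (fun τ => glueStress T θ v₀ v₁ R₀ R₁ τ y) = fun s => glueStress T θ v₀ v₁ R₀ R₁ s y from rfl, e]
  have hprod : a * (1 - a) ≤ 1 / 4 := by nlinarith [sq_nonneg (a - 1 / 2)]
  have hprod0 : 0 ≤ a * (1 - a) := mul_nonneg hθ0 (by linarith)
  have hcoef : |a' * (1 - a) + a * (0 - a')| ≤ |a'| := by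
    rw [show a' * (1 - a) + a * (0 - a') = a' * (1 - 2 * a) by ring, abs_mul]
    have : |1 - 2 * a| ≤ 1 := by rw [abs_le]; constructor <;> linarith
    exact mul_le_of_le_one_right (abs_nonneg _) this
  have hsq : ‖tracelessSq (glueDiff v₀ v₁ t) y‖ ≤ 2 * D₀ ^ 2 :=
    (norm_tracelessSq_le _ y).trans (by have := hD y; have h0 := norm_nonneg (glueDiff v₀ v₁ t y); nlinarith)
  have hDT : ‖DT‖ ≤ 4 * D₀ * Dt := by
    refine (norm_timeDerivWithin_tracelessSq_le hdst hU ht y).trans ?_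
    have := hD y; have := hDt y
    gcongr
  have hDA : ‖DA‖ ≤ K * (|a''| * D₀ + |a'| * Dt) := by
    refine norm_timeDerivWithin_antidivergence_le hK hT hrd ht (by positivity) (fun z => ?_) y
    have kd := hdst.hasDerivWithinAt_slice ht z
    have kz : HasDerivWithinAt (fun s => glueRate T θ s • glueDiff v₀ v₁ s z)
        (glueRate T θ t • FunctionSpaces.Torus.timeDerivWithin (Icc 0 T) (glueDiff v₀ v₁) t z + a'' • glueDiff v₀ v₁ t z) (Icc 0 T) t :=
      hθ'd.smul kd
    have ez := kz.derivWithin (hU t ht)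
    unfold FunctionSpaces.Torus.timeDerivWithin at ez ⊢
    rw [show (fun τ => glueRate T θ τ • glueDiff v₀ v₁ τ z) = fun s => glueRate T θ s • glueDiff v₀ v₁ s z from rfl, ez]
    calc ‖glueRate T θ t • derivWithin (fun τ => glueDiff v₀ v₁ τ z) (Icc 0 T) t + a'' • glueDiff v₀ v₁ t z‖
        ≤ ‖glueRate T θ t • derivWithin (fun τ => glueDiff v₀ v₁ τ z) (Icc 0 T) t‖ + ‖a'' • glueDiff v₀ v₁ t z‖ := norm_add_le _ _
      _ ≤ |a'| * Dt + |a''| * D₀ := by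
          rw [norm_smul, norm_smul, Real.norm_eq_abs, Real.norm_eq_abs]
          exact add_le_add (mul_le_mul_of_nonneg_left (hDt z) (abs_nonneg _)) (mul_le_mul_of_nonneg_left (hD z) (abs_nonneg _))
      _ = |a''| * D₀ + |a'| * Dt := by ring
  have p1 : ‖(1 - θ t) • DR₀‖ = (1 - θ t) * ‖DR₀‖ := by rw [norm_smul, Real.norm_eq_abs, abs_of_nonneg (by linarith)]
  have p2 : ‖θ t • DR₁‖ = θ t * ‖DR₁‖ := by rw [norm_smul, Real.norm_eq_abs, abs_of_nonneg hθ0]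
  calc ‖((1 - θ t) • DR₀ + (0 - a') • R₀ t y) + (θ t • DR₁ + a' • R₁ t y) -
        ((θ t * (1 - θ t)) • DT + (a' * (1 - a) + a * (0 - a')) • tracelessSq (glueDiff v₀ v₁ t) y) + DA‖
      ≤ ((‖(1 - θ t) • DR₀‖ + ‖(0 - a') • R₀ t y‖) + (‖θ t • DR₁‖ + ‖a' • R₁ t y‖) +
          (‖(θ t * (1 - θ t)) • DT‖ + ‖(a' * (1 - a) + a * (0 - a')) • tracelessSq (glueDiff v₀ v₁ t) y‖)) + ‖DA‖ := by
        refine (norm_add_le _ _).trans (add_le_add ?_ le_rfl)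
        refine (norm_sub_le _ _).trans (add_le_add ((norm_add_le _ _).trans (add_le_add (norm_add_le _ _) (norm_add_le _ _))) (norm_add_le _ _))
    _ ≤ (((1 - θ t) * ‖DR₀‖ + |a'| * ‖R₀ t y‖) + (θ t * ‖DR₁‖ + |a'| * ‖R₁ t y‖) + ((1 / 4) * (4 * D₀ * Dt) + |a'| * (2 * D₀ ^ 2))) +
          K * (|a''| * D₀ + |a'| * Dt) := by
        rw [p1, p2]
        gcongr
        · rw [norm_smul, Real.norm_eq_abs, zero_sub, abs_neg]
        · rw [norm_smul, Real.norm_eq_abs]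
        · rw [norm_smul, Real.norm_eq_abs, abs_of_nonneg hprod0]
          exact mul_le_mul hprod hDT (norm_nonneg _) (by norm_num)
        · rw [norm_smul, Real.norm_eq_abs]
          exact mul_le_mul hcoef hsq (norm_nonneg _) (abs_nonneg _)
    _ = |a'| * (‖R₀ t y‖ + ‖R₁ t y‖) + (1 - θ t) * ‖DR₀‖ + θ t * ‖DR₁‖ + 2 * |a'| * D₀ ^ 2 + D₀ * Dt + K * (|a''| * D₀ + |a'| * Dt) := by ring

omit hT hθ in
/-- **`L¹` size of the glued stress**: `∫‖R_θ(t)‖ ≤ ∫‖R₀(t)‖ + ∫‖R₁(t)‖ + D₀²/2 + K|θ'|D₀`. [folklore] -/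
theorem integral_norm_glueStress_le {K : ℝ}
    (hK : ∀ (w : UnitAddTorus d → EuclideanSpace ℝ d), IsSmooth w → ∀ C : ℝ, 0 ≤ C → (∀ x, ‖w x‖ ≤ C) → ∀ x, ‖antidivergence w x‖ ≤ K * C)
    (hRS : FunctionSpaces.Torus.IsSmoothSpaceTimeOn (Icc 0 T) (glueStress T θ v₀ v₁ R₀ R₁))
    {t : ℝ} (ht : t ∈ Icc 0 T) (hθ0 : 0 ≤ θ t) (hθ1 : θ t ≤ 1) {D₀ : ℝ} (hD0 : 0 ≤ D₀)
    (hD : ∀ z, ‖glueDiff v₀ v₁ t z‖ ≤ D₀) :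
    ∫ y, ‖glueStress T θ v₀ v₁ R₀ R₁ t y‖ ≤ (∫ y, ‖R₀ t y‖) + (∫ y, ‖R₁ t y‖) + D₀ ^ 2 / 2 + K * (|glueRate T θ t| * D₀) := by
  have hpt := fun y => norm_glueStress_le h₀ h₁ hK ht hθ0 hθ1 hD0 hD y
  have c0 : Continuous fun y => ‖R₀ t y‖ := (h₀.smooth_stress.isSmooth_slice ht).continuous.norm
  have c1 : Continuous fun y => ‖R₁ t y‖ := (h₁.smooth_stress.isSmooth_slice ht).continuous.norm
  have cg : Continuous fun y => ‖glueStress T θ v₀ v₁ R₀ R₁ t y‖ := (hRS.isSmooth_slice ht).continuous.norm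
  have i0 : Integrable (fun y => ‖R₀ t y‖) volume := c0.integrable_unitAddTorus
  have i1 : Integrable (fun y => ‖R₁ t y‖) volume := c1.integrable_unitAddTorus
  have ic : Integrable (fun (_ : UnitAddTorus d) => D₀ ^ 2 / 2 + K * (|glueRate T θ t| * D₀)) volume := integrable_const _
  have i01 : Integrable (fun y => ‖R₀ t y‖ + ‖R₁ t y‖) volume := i0.add i1
  calc ∫ y, ‖glueStress T θ v₀ v₁ R₀ R₁ t y‖ ≤ ∫ y, (‖R₀ t y‖ + ‖R₁ t y‖ + (D₀ ^ 2 / 2 + K * (|glueRate T θ t| * D₀))) :=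
        integral_mono cg.integrable_unitAddTorus (i01.add ic) fun y => by have := hpt y; linarith
    _ = (∫ y, ‖R₀ t y‖) + (∫ y, ‖R₁ t y‖) + D₀ ^ 2 / 2 + K * (|glueRate T θ t| * D₀) := by
        rw [integral_add i01 ic, integral_add i0 i1, integral_const]; simp; ring

end Torus

namespace EnergyPump

end EnergyPump

end Literature.Analysis.FluidPDE
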